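import Literature.AnabelianGeometry.AbsoluteAnabelian.SlimOfTorallyKummerFaithfulProofs
import HarnessLib

/-!
# Slimness of `G_K` for torally Kummer-faithful fields: the cyclotomic dichotomy, part 1
# (Kummer steps; bears on [AbsAnab] Thm 1.1.1 (ii) and [AbsTopIII] Thm 1.11 (c))

S. Mochizuki, *The Absolute Anabelian Geometry of Hyperbolic Curves* (2004) [AbsAnab], Thm 1.1.1 (ii)
p. 6 ("`G_F`, `G_𝔭` are slim"), and *Topics in Absolute Anabelian Geometry III* [AbsTopIII], Thm 1.11
p. 45, conjunct (c) ("`G_k` [is] slim" for `k` Kummer-faithful; contradicted in print in general by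
T. Asayama, arXiv:2601.10298 (2026), Cor 1.5 / Rmk 1.6 — cell abc-iut FACT-LIST row F-0337
`AbsTopIII.Thm_1_11_slim`, conditional).

The tree's engine `isSlimGroup_absoluteGaloisGroup_of_isTorallyKummerFaithful`
(`SlimOfTorallyKummerFaithfulProofs.lean`) proves (c) for torally Kummer-faithful `K` admitting a
homomorphism `v : K^× → ℤ` that does not vanish identically.  This PROOF-ONLY file (no definitions)
removes the valuation and isolates what it was used for.  For `σ ∈ Gal(K̄/K)` commuting with
`Gal(K̄/E₀)` the Kummer step gives `σ(a) = βⁿ a^m` on `E₀^×` (`β ∈ E₀`, `σζ = ζ^m` on `μ_n`), hence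
`a^{1-m} ∈ (E₀^×)ⁿ` for every `a ∈ K^×`.  DICHOTOMY on the action of `σ` on roots of unity:

* (A) `exists_mem_pow_eq_pow_of_comm_of_ne` — if `σ` moves a root of unity of order dividing
  `r^{c+1}` (`r` prime; `exists_prime_pow_rootOfUnity_ne` extracts such one from any moved root of
  unity), then at level `n = r^{j+c+1}` one has `r^{c+1} ∤ 1 - m`, and Bezout turns
  `a^{1-m} ∈ (E₀^×)ⁿ` into: `a^{r^c}` IS AN `r^j`-TH POWER IN `E₀` for EVERY `a ∈ K^×` and EVERY `j`
  (no Kummer-faithfulness used);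
* (B) `algEquiv_apply_eq_self_of_comm_of_forall_rootOfUnity` — if `σ` fixes every root of unity,
  the Kummer step holds with `m = 1`, so `σ(x)/x ∈ ⋂_N (M^×)^N` for `M = E₀(x)` (finite over `K`),
  and toral Kummer-faithfulness gives `σ = 1`.

The sequel `SlimOfTorallyKummerFaithfulRadicalEngineProofs.lean` assembles the new slimness engine
(torally Kummer-faithful + a radical non-divisibility condition ⟹ slim), re-derives the `ℤ`-valued
engine from it, and records the consequence for F-0337: a Kummer-faithful field refuting
`Thm_1_11_slim` is "radically divisible".  HONEST FRAMING: classical Kummer theory; nothing here bears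
on [IUTchIII] Cor 3.12; no side taken. [cite: MochizukiAbsAnab2004, Thm 1.1.1 (ii) p.6]
[cite: MochizukiAbsTopIII2015, Thm 1.11 p.45] [cite: Asayama2026KummerFaithfulFG, Cor 1.5]
-/

noncomputable section

open scoped Classical IntermediateField

namespace Literature.AnabelianGeometry.AbsoluteAnabelian

open Field IntermediateField
open Literature.AlgebraicGeometry.Frobenioids (IsSlimGroup)
open AbsTopIII

universe u

section General

variable {K : Type u} [Field K] [CharZero K]

/-- Infinite Galois theory for `K̄/K` (`char K = 0`): an open subgroup of `Gal(K̄/K)` is `Gal(K̄/E)`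
for a finite subextension `E` ([AbsAnab] Lemma 1.1.4, proof, p. 7: "open subgroups ... correspond to
finite extensions"; public, universe-polymorphic copy of the private lemma of
`SlimOfTorallyKummerFaithfulProofs`, for the sequel file). [cite: MochizukiAbsAnab2004, Lemma 1.1.4 proof p.7] -/
theorem exists_finiteDimensional_fixingSubgroup_comap_eq_of_isOpen (N : Subgroup (absoluteGaloisGroup K))
    (hN : IsOpen (N : Set (absoluteGaloisGroup K))) :
    ∃ E : IntermediateField K (AlgebraicClosure K), FiniteDimensional K E ∧
      E.fixingSubgroup.comap (absoluteGaloisGroup.toAlgEquiv K).toMonoidHom = N := by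
  have hc : IsClosed (N : Set (absoluteGaloisGroup K)) := N.isClosed_of_isOpen hN
  let N' : ClosedSubgroup (AlgebraicClosure K ≃ₐ[K] AlgebraicClosure K) :=
    ⟨(N : Subgroup (AlgebraicClosure K ≃ₐ[K] AlgebraicClosure K)), hc⟩
  have hfix : (IntermediateField.fixedField N'.1).fixingSubgroup = N'.1 :=
    InfiniteGalois.fixingSubgroup_fixedField N'
  refine ⟨IntermediateField.fixedField N'.1, ?_, ?_⟩
  · rw [← InfiniteGalois.isOpen_iff_finite, hfix]
    exact hN
  · rw [hfix]
    ext σ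
    exact Iff.rfl

/-- KUMMER STEP with the cyclotomic exponent recorded: for `σ ∈ Gal(K̄/K)` commuting with `Gal(K̄/M)`
and `n ≥ 1` there is `m ∈ ℤ` with `σζ = ζ^m` for every `ζ ∈ μ_n(K̄)` and `σ(a) = βⁿ · a^m`, `β ∈ M^×`,
for all `a ∈ M^×`. [cite: MochizukiAbsAnab2004, Thm 1.1.1 (ii) p.6] -/
private theorem exists_int_cyclotomic_forall_sigma_eq (M : IntermediateField K (AlgebraicClosure K))
    (σ : AlgebraicClosure K ≃ₐ[K] AlgebraicClosure K)
    (hσ : ∀ τ ∈ M.fixingSubgroup, ∀ y : AlgebraicClosure K, τ (σ y) = σ (τ y))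
    {n : ℕ} (hn : 0 < n) :
    ∃ m : ℤ, (∀ ζ : AlgebraicClosure K, ζ ^ n = 1 → σ ζ = ζ ^ m) ∧
      ∀ a : AlgebraicClosure K, a ∈ M → a ≠ 0 →
        ∃ β : AlgebraicClosure K, β ∈ M ∧ β ≠ 0 ∧ σ a = β ^ n * a ^ m := by
  haveI : NeZero n := ⟨hn.ne'⟩
  obtain ⟨m, hm⟩ := rootsOfUnity.integer_power_of_ringEquiv n (σ : AlgebraicClosure K ≃+* _)
  have hmζ : ∀ ζ : AlgebraicClosure K, ζ ^ n = 1 → σ ζ = ζ ^ m := by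
    intro ζ hζ
    have hζ0 : ζ ≠ 0 := by
      rintro rfl
      rw [zero_pow hn.ne'] at hζ
      exact zero_ne_one hζ
    set ζu : (AlgebraicClosure K)ˣ := Units.mk0 ζ hζ0 with hζu
    have hζmem : ζu ∈ rootsOfUnity n (AlgebraicClosure K) := by
      rw [mem_rootsOfUnity]
      exact Units.ext (by simp [hζu, hζ])
    have := hm ⟨ζu, hζmem⟩
    simpa [hζu, Units.val_zpow_eq_zpow_val] using this
  refine ⟨m, hmζ, fun a haM ha0 => ?_⟩
  obtain ⟨α, hα⟩ := IsAlgClosed.exists_pow_nat_eq a hn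
  have hα0 : α ≠ 0 := by
    rintro rfl
    rw [zero_pow hn.ne'] at hα
    exact ha0 hα.symm
  set β : AlgebraicClosure K := σ α / α ^ m with hβdef
  have hβ0 : β ≠ 0 := by
    rw [hβdef]
    exact div_ne_zero ((map_ne_zero σ).mpr hα0) (zpow_ne_zero _ hα0)
  have hβM : β ∈ M := by
    rw [← InfiniteGalois.fixedField_fixingSubgroup M, IntermediateField.mem_fixedField_iff]
    intro τ hτ
    have hτa : τ a = a := (IntermediateField.mem_fixingSubgroup_iff _ _).mp hτ a haM
    have hζn : (τ α / α) ^ n = 1 := by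
      rw [div_pow, ← map_pow, hα, hτa, div_self ha0]
    have hζ0 : τ α / α ≠ 0 := div_ne_zero ((map_ne_zero τ).mpr hα0) hα0
    have hσζ : σ (τ α / α) = (τ α / α) ^ m := hmζ _ hζn
    have hτα : τ α = (τ α / α) * α := by rw [div_mul_cancel₀ _ hα0]
    rw [hβdef, map_div₀, map_zpow₀, hσ τ hτ α, hτα, map_mul, hσζ, mul_zpow]
    field_simp
  refine ⟨β, hβM, hβ0, ?_⟩
  have hσα : σ α = β * α ^ m := by rw [hβdef, div_mul_cancel₀ _ (zpow_ne_zero _ hα0)]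
  calc σ a = σ (α ^ n) := by rw [hα]
    _ = (β * α ^ m) ^ n := by rw [map_pow, hσα]
    _ = β ^ n * (α ^ n) ^ m := by rw [mul_pow, ← zpow_natCast (α ^ m), ← zpow_mul, mul_comm m,
        zpow_mul, zpow_natCast]
    _ = β ^ n * a ^ m := by rw [hα]

/-- KUMMER STEP at a level whose roots of unity `σ` FIXES: then `σ(a) = βⁿ · a` with `β ∈ M^×` for all
`a ∈ M^×` (the exponent is `m = 1`). [cite: MochizukiAbsAnab2004, Thm 1.1.1 (ii) p.6] -/
private theorem exists_forall_sigma_eq_of_forall_rootOfUnity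
    (M : IntermediateField K (AlgebraicClosure K)) (σ : AlgebraicClosure K ≃ₐ[K] AlgebraicClosure K)
    (hσ : ∀ τ ∈ M.fixingSubgroup, ∀ y : AlgebraicClosure K, τ (σ y) = σ (τ y))
    {n : ℕ} (hn : 0 < n) (hfix : ∀ ζ : AlgebraicClosure K, ζ ^ n = 1 → σ ζ = ζ) :
    ∀ a : AlgebraicClosure K, a ∈ M → a ≠ 0 →
      ∃ β : AlgebraicClosure K, β ∈ M ∧ β ≠ 0 ∧ σ a = β ^ n * a := by
  intro a haM ha0
  obtain ⟨α, hα⟩ := IsAlgClosed.exists_pow_nat_eq a hn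
  have hα0 : α ≠ 0 := by
    rintro rfl
    rw [zero_pow hn.ne'] at hα
    exact ha0 hα.symm
  set β : AlgebraicClosure K := σ α / α with hβdef
  have hβ0 : β ≠ 0 := by
    rw [hβdef]
    exact div_ne_zero ((map_ne_zero σ).mpr hα0) hα0
  have hβM : β ∈ M := by
    rw [← InfiniteGalois.fixedField_fixingSubgroup M, IntermediateField.mem_fixedField_iff]
    intro τ hτ
    have hτa : τ a = a := (IntermediateField.mem_fixingSubgroup_iff _ _).mp hτ a haM
    have hζn : (τ α / α) ^ n = 1 := by
      rw [div_pow, ← map_pow, hα, hτa, div_self ha0]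
    have hτα0 : τ α ≠ 0 := (map_ne_zero τ).mpr hα0
    have hσζ : σ (τ α / α) = τ α / α := hfix _ hζn
    have hτα : τ α = (τ α / α) * α := by rw [div_mul_cancel₀ _ hα0]
    rw [hβdef, map_div₀, hσ τ hτ α, hτα, map_mul, hσζ]
    field_simp
  refine ⟨β, hβM, hβ0, ?_⟩
  have hσα : σ α = β * α := by rw [hβdef, div_mul_cancel₀ _ hα0]
  calc σ a = σ (α ^ n) := by rw [hα]
    _ = (β * α) ^ n := by rw [map_pow, hσα]
    _ = β ^ n * a := by rw [mul_pow, hα]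

omit [CharZero K] in
/-- From a root of unity moved by `σ` to one of PRIME-POWER order moved by `σ` (coprime splitting of
`μ_n`). [folklore] -/
private theorem exists_prime_pow_rootOfUnity_ne (σ : AlgebraicClosure K ≃ₐ[K] AlgebraicClosure K)
    {n : ℕ} (hn : 0 < n) {ζ : AlgebraicClosure K} (hζ : ζ ^ n = 1) (hne : σ ζ ≠ ζ) :
    ∃ r : ℕ, r.Prime ∧ ∃ (c : ℕ) (ζ₁ : AlgebraicClosure K), ζ₁ ^ (r ^ (c + 1)) = 1 ∧ σ ζ₁ ≠ ζ₁ := by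
  induction n using Nat.strong_induction_on generalizing ζ with
  | _ n ih =>
    by_cases hn1 : n = 1
    · subst hn1
      rw [pow_one] at hζ
      subst hζ
      exact absurd (map_one σ) hne
    have hn1' : n ≠ 1 := hn1
    set r : ℕ := n.minFac with hrdef
    have hr : r.Prime := Nat.minFac_prime hn1'
    have hrn : r ∣ n := Nat.minFac_dvd n
    set e : ℕ := n.factorization r with hedef
    have he : 0 < e := hr.factorization_pos_of_dvd hn.ne' hrn
    set n' : ℕ := n / r ^ e with hn'def
    have hmul : r ^ e * n' = n := Nat.ordProj_mul_ordCompl_eq_self n r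
    have hcop : Nat.Coprime (r ^ e) n' := (Nat.coprime_ordCompl hr hn.ne').pow_left e
    have hre1 : 1 < r ^ e := Nat.one_lt_pow he.ne' hr.one_lt
    have hn'pos : 0 < n' := by
      rcases Nat.eq_zero_or_pos n' with h | h
      · rw [h, mul_zero] at hmul
        omega
      · exact h
    have hn'lt : n' < n := by
      rw [hn'def]
      exact Nat.div_lt_self hn hre1
    have hζ0 : ζ ≠ 0 := by
      rintro rfl
      rw [zero_pow hn.ne'] at hζ
      exact zero_ne_one hζ
    -- the two components of `ζ`
    have hζ₁ : (ζ ^ n') ^ (r ^ e) = 1 := by rw [← pow_mul, mul_comm, hmul, hζ]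
    have hζ₂ : (ζ ^ (r ^ e)) ^ n' = 1 := by rw [← pow_mul, hmul, hζ]
    by_cases h1 : σ (ζ ^ n') = ζ ^ n'
    · by_cases h2 : σ (ζ ^ (r ^ e)) = ζ ^ (r ^ e)
      · -- both components fixed: `ζ` is fixed (Bezout), contradiction
        exfalso
        obtain ⟨u, v, huv⟩ := Nat.isCoprime_iff_coprime.mpr hcop
        apply hne
        have hζeq : ζ = (ζ ^ (r ^ e)) ^ u * (ζ ^ n') ^ v := by
          rw [← zpow_natCast ζ (r ^ e), ← zpow_natCast ζ n', ← zpow_mul, ← zpow_mul,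
            ← zpow_add₀ hζ0]
          have : ((r ^ e : ℕ) : ℤ) * u + (n' : ℤ) * v = 1 := by
            push_cast at huv ⊢
            linear_combination huv
          rw [this, zpow_one]
        conv_lhs => rw [hζeq]
        rw [map_mul, map_zpow₀, map_zpow₀, h1, h2, ← hζeq]
      · exact ih n' hn'lt hn'pos hζ₂ h2
    · refine ⟨r, hr, e - 1, ζ ^ n', ?_, h1⟩
      rw [Nat.sub_add_cancel he]
      exact hζ₁

/-- **(A) The radical branch of the dichotomy.**  Let `σ ∈ Gal(K̄/K)` commute with `Gal(K̄/E₀)` for a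
subextension `E₀`, and suppose `σ` moves a root of unity of order dividing `r^{c+1}` (`r` prime).  Then
for EVERY `a ∈ K^×` and EVERY `j`, `a^{r^c}` is an `r^j`-th power in `E₀`.  (Kummer step at level
`n = r^{j+c+1}`: `a^{1-m} ∈ (E₀^×)ⁿ` with `r^{c+1} ∤ 1 - m`; Bezout.)  No Kummer-faithfulness is used.
[cite: MochizukiAbsAnab2004, Thm 1.1.1 (ii) p.6] -/
theorem exists_mem_pow_eq_pow_of_comm_of_ne (E₀ : IntermediateField K (AlgebraicClosure K))
    (σ : AlgebraicClosure K ≃ₐ[K] AlgebraicClosure K)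
    (hσ : ∀ τ ∈ E₀.fixingSubgroup, ∀ y : AlgebraicClosure K, τ (σ y) = σ (τ y))
    {r : ℕ} (hr : r.Prime) {c : ℕ} {ζ₁ : AlgebraicClosure K} (hζ₁ : ζ₁ ^ (r ^ (c + 1)) = 1)
    (hne : σ ζ₁ ≠ ζ₁) (a : K) (ha : a ≠ 0) (j : ℕ) :
    ∃ b : AlgebraicClosure K, b ∈ E₀ ∧ b ≠ 0 ∧
      b ^ (r ^ j) = algebraMap K (AlgebraicClosure K) a ^ (r ^ c) := by
  set n : ℕ := r ^ (j + (c + 1)) with hndef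
  have hn : 0 < n := pow_pos hr.pos _
  obtain ⟨m, hmζ, hm⟩ := exists_int_cyclotomic_forall_sigma_eq E₀ σ hσ hn
  -- `σ ζ₁ = ζ₁ ^ m` and `r^{c+1} ∤ m - 1`
  have hζ₁0 : ζ₁ ≠ 0 := by
    rintro rfl
    rw [zero_pow (pow_ne_zero _ hr.ne_zero)] at hζ₁
    exact zero_ne_one hζ₁
  have hζ₁n : ζ₁ ^ n = 1 := by
    rw [hndef, pow_add, mul_comm, pow_mul, hζ₁, one_pow]
  have hσζ₁ : σ ζ₁ = ζ₁ ^ m := hmζ ζ₁ hζ₁n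
  have hndvd : ¬ ((r ^ (c + 1) : ℕ) : ℤ) ∣ m - 1 := by
    rintro ⟨k, hk⟩
    apply hne
    rw [hσζ₁, show m = 1 + (r ^ (c + 1) : ℕ) * k by linear_combination hk, zpow_add₀ hζ₁0, zpow_one,
      zpow_mul, zpow_natCast, hζ₁, one_zpow, mul_one]
  -- `d := gcd(m - 1, n) = r^t` with `t ≤ c`
  set d : ℕ := Int.gcd (m - 1) n with hddef
  have hdn : d ∣ n := by
    have h := Int.gcd_dvd_right (m - 1) n
    rw [← hddef] at h
    exact Int.natCast_dvd_natCast.mp h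
  obtain ⟨t, -, hdt⟩ := (Nat.dvd_prime_pow hr).1 hdn
  have hdm : (d : ℤ) ∣ m - 1 := by
    have h := Int.gcd_dvd_left (m - 1) n
    rw [← hddef] at h
    exact h
  have htc : t ≤ c := by
    by_contra htc
    push Not at htc
    apply hndvd
    have h1 : ((r ^ (c + 1) : ℕ) : ℤ) ∣ (d : ℤ) := by
      rw [hdt]
      exact_mod_cast pow_dvd_pow r (by omega : c + 1 ≤ t)
    exact h1.trans hdm
  -- Bezout: `d = (m - 1) * A + n * B`
  have hbez : (d : ℤ) = (m - 1) * Int.gcdA (m - 1) n + n * Int.gcdB (m - 1) n := by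
    rw [hddef]
    exact Int.gcd_eq_gcd_ab (m - 1) n
  set A : ℤ := Int.gcdA (m - 1) n with hAdef
  set B : ℤ := Int.gcdB (m - 1) n with hBdef
  -- the element `a` of `K`, seen in `K̄`, and its Kummer relation
  set aΩ : AlgebraicClosure K := algebraMap K (AlgebraicClosure K) a with haΩdef
  have haΩ0 : aΩ ≠ 0 := by
    rw [haΩdef, map_ne_zero]
    exact ha
  have haΩE : aΩ ∈ E₀ := E₀.algebraMap_mem a
  obtain ⟨β, hβE, hβ0, hσa⟩ := hm aΩ haΩE haΩ0
  have hσaΩ : σ aΩ = aΩ := by rw [haΩdef, AlgEquiv.commutes]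
  rw [hσaΩ] at hσa
  -- `aΩ ^ (1 - m) = β ^ n`
  have h1m : aΩ ^ ((1 : ℤ) - m) = β ^ (n : ℤ) := by
    rw [zpow_sub₀ haΩ0, zpow_one, zpow_natCast, div_eq_iff (zpow_ne_zero m haΩ0)]
    exact hσa
  -- `aΩ ^ d = γ ^ n` with `γ := β ^ (-A) * aΩ ^ B ∈ E₀`
  set γ : AlgebraicClosure K := β ^ (-A) * aΩ ^ B with hγdef
  have hγ0 : γ ≠ 0 := mul_ne_zero (zpow_ne_zero _ hβ0) (zpow_ne_zero _ haΩ0)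
  have hγE : γ ∈ E₀ := mul_mem (zpow_mem hβE _) (zpow_mem haΩE _)
  have h2 : aΩ ^ (m - 1) = (β ^ (n : ℤ))⁻¹ := by
    rw [show m - 1 = -((1 : ℤ) - m) by ring, zpow_neg, h1m]
  have hAd : aΩ ^ (d : ℤ) = γ ^ (n : ℤ) := by
    rw [hbez, zpow_add₀ haΩ0, zpow_mul aΩ (m - 1) A, h2, ← zpow_neg, ← zpow_mul β (-(n : ℤ)) A,
      hγdef, mul_zpow, ← zpow_mul β (-A) n, ← zpow_mul aΩ B n]
    congr 1 <;> (congr 1; ring)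
  -- assemble: `b := γ ^ (r ^ (c + 1) * r ^ (c - t))`
  have hAdnat : aΩ ^ d = γ ^ n := by
    rw [← zpow_natCast, hAd, zpow_natCast]
  refine ⟨γ ^ (r ^ (c + 1) * r ^ (c - t)), pow_mem hγE _, pow_ne_zero _ hγ0, ?_⟩
  have hrc : r ^ c = d * r ^ (c - t) := by
    rw [hdt, ← pow_add, Nat.add_sub_cancel' htc]
  rw [hrc, pow_mul aΩ d, hAdnat, ← pow_mul, ← pow_mul, hndef]
  congr 1
  ring

/-- **(A), general form**: if `σ ∈ Gal(K̄/K)` commutes with `Gal(K̄/E₀)` and moves SOME root of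
unity, then for some prime `r` and some `c`, `a^{r^c}` is an `r^j`-th power in `E₀` for every
`a ∈ K^×` and every `j` (reduce to a root of unity of prime-power order, then apply
`exists_mem_pow_eq_pow_of_comm_of_ne`). [cite: MochizukiAbsAnab2004, Thm 1.1.1 (ii) p.6] -/
theorem exists_prime_forall_mem_pow_eq_pow_of_comm (E₀ : IntermediateField K (AlgebraicClosure K))
    (σ : AlgebraicClosure K ≃ₐ[K] AlgebraicClosure K)
    (hσ : ∀ τ ∈ E₀.fixingSubgroup, ∀ y : AlgebraicClosure K, τ (σ y) = σ (τ y))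
    (hne : ∃ (n : ℕ) (ζ : AlgebraicClosure K), 0 < n ∧ ζ ^ n = 1 ∧ σ ζ ≠ ζ) :
    ∃ r : ℕ, r.Prime ∧ ∃ c : ℕ, ∀ a : K, a ≠ 0 → ∀ j : ℕ,
      ∃ b : AlgebraicClosure K, b ∈ E₀ ∧ b ≠ 0 ∧
        b ^ (r ^ j) = algebraMap K (AlgebraicClosure K) a ^ (r ^ c) := by
  obtain ⟨n, ζ, hn, hζ, hσζ⟩ := hne
  obtain ⟨r, hr, c, ζ₁, hζ₁, hne₁⟩ := exists_prime_pow_rootOfUnity_ne σ hn hζ hσζ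
  exact ⟨r, hr, c, fun a ha j => exists_mem_pow_eq_pow_of_comm_of_ne E₀ σ hσ hr hζ₁ hne₁ a ha j⟩

/-- **(B) The rigid branch of the dichotomy.**  Let `K` be torally Kummer-faithful, `E₀/K` a finite
subextension, and `σ ∈ Gal(K̄/K)` commuting with `Gal(K̄/E₀)` and fixing EVERY root of unity of `K̄`.
Then `σ = 1`: the Kummer step at level `N` has exponent `m = 1`, so `σ(x)/x ∈ (M^×)^N` for all `N`
(`M := E₀(x)`, finite over `K`), i.e. `σ(x)/x` is divisible in `M^×`, hence trivial.
[cite: MochizukiAbsAnab2004, Thm 1.1.1 (ii) p.6] -/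
theorem algEquiv_apply_eq_self_of_comm_of_forall_rootOfUnity (hK : IsTorallyKummerFaithful K)
    (E₀ : IntermediateField K (AlgebraicClosure K)) [FiniteDimensional K E₀]
    (σ : AlgebraicClosure K ≃ₐ[K] AlgebraicClosure K)
    (hσ : ∀ τ ∈ E₀.fixingSubgroup, ∀ y : AlgebraicClosure K, τ (σ y) = σ (τ y))
    (hfix : ∀ (n : ℕ) (ζ : AlgebraicClosure K), 0 < n → ζ ^ n = 1 → σ ζ = ζ)
    (x : AlgebraicClosure K) : σ x = x := by
  haveI : Algebra.IsAlgebraic K (AlgebraicClosure K) := AlgebraicClosure.isAlgebraic K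
  by_cases hx0 : x = 0
  · rw [hx0, map_zero]
  haveI : FiniteDimensional K K⟮x⟯ :=
    IntermediateField.adjoin.finiteDimensional (Algebra.IsIntegral.isIntegral x)
  set M : IntermediateField K (AlgebraicClosure K) := E₀ ⊔ K⟮x⟯ with hMdef
  haveI : FiniteDimensional K M := IntermediateField.finiteDimensional_sup E₀ K⟮x⟯
  have hxM : x ∈ M := (le_sup_right : K⟮x⟯ ≤ M) (IntermediateField.mem_adjoin_simple_self K x)
  have hcomm : ∀ τ ∈ M.fixingSubgroup, ∀ y : AlgebraicClosure K, τ (σ y) = σ (τ y) := by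
    intro τ hτ y
    have hτE₀ : τ ∈ E₀.fixingSubgroup := by
      rw [IntermediateField.mem_fixingSubgroup_iff] at hτ ⊢
      exact fun z hz => hτ z ((le_sup_left : E₀ ≤ M) hz)
    exact hσ τ hτE₀ y
  have hσxM : σ x ∈ M := by
    rw [← InfiniteGalois.fixedField_fixingSubgroup M, IntermediateField.mem_fixedField_iff]
    intro τ hτ
    rw [hcomm τ hτ x, (IntermediateField.mem_fixingSubgroup_iff _ _).mp hτ x hxM]
  have hσx0 : σ x ≠ 0 := (map_ne_zero σ).mpr hx0
  set xM : M := ⟨x, hxM⟩ with hxMdef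
  set sxM : M := ⟨σ x, hσxM⟩ with hsxMdef
  have hxM0 : xM ≠ 0 := fun h => hx0 (congrArg Subtype.val h)
  have hsxM0 : sxM ≠ 0 := fun h => hσx0 (congrArg Subtype.val h)
  set u : (M : Type u)ˣ := Units.mk0 sxM hsxM0 / Units.mk0 xM hxM0 with hudef
  have hdiv : ∀ N : ℕ, 0 < N → ∃ b : (M : Type u)ˣ, b ^ N = u := by
    intro N hN
    obtain ⟨β, hβM, hβ0, hσx⟩ :=
      exists_forall_sigma_eq_of_forall_rootOfUnity M σ hcomm hN (fun ζ hζ => hfix N ζ hN hζ) x hxM hx0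
    have hb0 : (⟨β, hβM⟩ : M) ≠ 0 := fun h => hβ0 (congrArg Subtype.val h)
    refine ⟨Units.mk0 _ hb0, ?_⟩
    apply Units.ext
    apply Subtype.ext
    change β ^ N = σ x / x
    rw [hσx, mul_div_assoc, div_self hx0, mul_one]
  have hu1 : u = 1 := (hK.units M inferInstance).eq_one_of_forall_exists_pow u hdiv
  have := congrArg (fun w : (M : Type u)ˣ => ((w : M) : AlgebraicClosure K)) hu1
  simp only [hudef, Units.val_div_eq_div_val, Units.val_mk0, Units.val_one] at this
  have hval : ((sxM / xM : M) : AlgebraicClosure K) = σ x / x := rfl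
  rw [hval] at this
  simpa [div_eq_one_iff_eq hx0] using this

end General

end Literature.AnabelianGeometry.AbsoluteAnabelian
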